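import Literature.IUT.HodgeTheaters.TemperedCoveringsOfSpecialFibreFiniteGraph
import Literature.AnabelianGeometry.SemiGraphs.TemperedSpecialFibreTowerPiData
import Literature.AnabelianGeometry.SemiGraphs.TemperedCompactInVerticialFinite
import HarnessLib

/-!
# [SemiAnbd] Thm. 3.7 (iii)/(iv) and [IUTchI] Prop. 2.1 / 2.2 / Rmk. 2.2.2 at the special-fibre TOWER of a
# tempered curve, BY NAME from the finiteness record `SpecialFibreTower.FiniteLevels` — no `hCV` binder

Mochizuki, *Semi-graphs of anabelioids*, Publ. RIMS **42** (2006), Thm. 3.7 (iii)/(iv) pp. 40–41 ("since the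
semi-graphs `𝔾_j` are all finite", p. 41) and Ex. 3.10 pp. 43–45 (the special fibres `𝒢^c`, `𝒢^c_i` of a stable
curve and of its finite étale coverings) [cite: MochizukiSemiAnbd2006, Thm 3.7(iii) pp.40-41; Ex 3.10 pp.43-45];
Mochizuki, *Inter-universal Teichmüller theory I*, kurims manuscript (May 2020), §2 Prop. 2.1 / 2.2 p. 45,
Rmk. 2.2.2 p. 46, Prop. 2.4 (i) p. 50 ("by allowing `J` to vary") [cite: Mochizuki2012, Prop 2.1 p.45; Prop 2.4(i) p.50]
(D-0012 claim key; series status DISPUTED; nothing of the series is asserted here).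

PROOF-ONLY bridge (abc-iut cell, seat abc-iut-w4-d070 gen 6, L5-lead RULINGS #43 (3) row
«PROP21-AT-SPECIAL-FIBRE-FINITE», the `FiniteLevels` variant; no definition, no instance, no new `Prop` fact).
The base-fibre form with INSTANCE binders `[Finite S.Gc.graph.Vertex] [Finite S.Gc.graph.Edge]` is seat
abc-iut-f-192's `TemperedCoveringsOfSpecialFibreFiniteGraph.lean` (`graph_prop21_ofSpecialFibre_of_finiteGraph`, …);
this file serves the consumers that carry the finiteness of the special fibres AS THE NAMED RECORD
`SpecialFibreTower.FiniteLevels X d S T` (seat abc-iut-L3-t2, `TemperedSpecialFibreTowerPiData.lean`: "the dual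
graph of a pointed stable curve is finite", base `𝒢^c` AND every level `𝒢^c_i`), i.e. the Prop. 2.4 (i) tower
consumers (seat abc-iut-L5-t11's `prop21_levelGraph_byName (hCV : CompactInVerticialAt (T.Gc i))`,
`prop24i_ofSpecialFibre_byName (hCV : ∀ i, CompactInVerticialAt (T.Gc i))`, seat abc-iut-w4-d063's tower files):

* `SpecialFibreTower.FiniteLevels.compactInVerticialAt_base` / `…_level i` / `forall_compactInVerticialAt_level`
  — [SemiAnbd] Thm. 3.7 (iii) AT `S.Gc` and AT every `T.Gc i` (seat abc-iut-L3-t8's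
  `compactInVerticialAt_of_finiteGraph` under the record's finiteness), the exact dischargers of those `hCV`
  binders; the Thm. 3.7 (iv) / edge-like twins `maximalCompactIffVerticialAt_…`, `edgeLikeIsInfVerticialAt_…`,
  `edgeLikeDistinctAt_…`; and the first-clause BODIES at the structures' own hypotheses `S.hyp` / `T.hyp i`
  for every chart (`exists_verticial_ge_of_isCompact_base/_level`, `isMaximalCompactSubgroup_iff_base/_level`);
  the (iii) dischargers also keyed on the origin-data record `P : SpecialFibreTower.PiData X d S T`
  (`PiData.compactInVerticialAt_base/_level`, `PiData.forall_compactInVerticialAt_level`, via its field `finite`),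
  so that with `P.N_cofinal` (= the binder `hcof`) both tower binders are one-token re-binds;
* `StableCurveTemperedData.graph_prop21_ofSpecialFibre_of_finiteLevels` /
  `graph_tp_isCommensurablyTerminal_ofSpecialFibre_of_finiteLevels` /
  `graph_temperedNormallyTerminal_ofSpecialFibre_of_finiteLevels` — abc-iut-f-192's three base theorems at the
  genuine 𝔛-datum `ofSpecialFibre X d S h36 …` re-exported under `(hF : FiniteLevels X d S T)`.

One-line compositions; originals untouched.  HONEST RESIDUAL unchanged (verticial family, node data with (A3)).
`FiniteLevels` is an ORIGIN-CLASS hypothesis (true in print for stable curves; a binder, asserted for no curve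
here).  Typed ≠ proved for the [IUTchI] nodes at infinite graphs; nothing here bears on [IUTchIII] Cor. 3.12.
-/

namespace Literature.AnabelianGeometry.SemiGraphs

namespace SpecialFibreTower

namespace FiniteLevels

open ProfiniteSemiGraph

variable {p : ℕ} [Fact p.Prime] {X : TemperedCurve p} {d : X.GroupLevelData}
  {S : SpecialFibreData (X.toTemperedArithmeticGroup d)} {T : SpecialFibreTower X.DeltaTemp}
  (hF : FiniteLevels X d S T)

include hF

/-! ### [SemiAnbd] Thm. 3.7 (iii) at the base fibre and at every level, BY NAME -/

/-- **Thm. 3.7 (iii) AT the base special fibre `𝒢^c`** from the finiteness record (seat abc-iut-L3-t8's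
finite-graph theorem). [cite: MochizukiSemiAnbd2006, Thm 3.7(iii) p.41] -/
theorem compactInVerticialAt_base : CompactInVerticialAt S.Gc :=
  compactInVerticialAt_of_finiteGraph' hF.finite_vertex_base hF.finite_edge_base

/-- **Thm. 3.7 (iii) AT the level-`i` special fibre `𝒢^c_i`** from the finiteness record — the discharger of the
binder `hCV : CompactInVerticialAt (T.Gc i)` of the Prop. 2.4 (i) tower consumers.
[cite: MochizukiSemiAnbd2006, Thm 3.7(iii) p.41] -/
theorem compactInVerticialAt_level (i : ℕ) : CompactInVerticialAt (T.Gc i) :=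
  compactInVerticialAt_of_finiteGraph' (hF.finite_vertex i) (hF.finite_edge i)

/-- Thm. 3.7 (iii) at ALL levels at once (the shape `hCV : ∀ i, CompactInVerticialAt (T.Gc i)`).
[cite: MochizukiSemiAnbd2006, Thm 3.7(iii) p.41] -/
theorem forall_compactInVerticialAt_level : ∀ i, CompactInVerticialAt (T.Gc i) :=
  fun i => hF.compactInVerticialAt_level i

/-! ### Thm. 3.7 (iv) and the edge-like facts at the base fibre and at every level -/

/-- **Thm. 3.7 (iv) AT the base special fibre.** [cite: MochizukiSemiAnbd2006, Thm 3.7(iv) p.41] -/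
theorem maximalCompactIffVerticialAt_base : MaximalCompactIffVerticialAt S.Gc := by
  haveI := hF.finite_vertex_base
  haveI := hF.finite_edge_base
  exact maximalCompactIffVerticialAt_of_finiteGraph

/-- **Thm. 3.7 (iv) AT the level-`i` special fibre.** [cite: MochizukiSemiAnbd2006, Thm 3.7(iv) p.41] -/
theorem maximalCompactIffVerticialAt_level (i : ℕ) : MaximalCompactIffVerticialAt (T.Gc i) := by
  haveI := hF.finite_vertex i
  haveI := hF.finite_edge i
  exact maximalCompactIffVerticialAt_of_finiteGraph

/-- `EdgeLikeIsInfVerticialAt` at the base special fibre. [cite: MochizukiSemiAnbd2006, Thm 3.7(iv) p.41] -/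
theorem edgeLikeIsInfVerticialAt_base : EdgeLikeIsInfVerticialAt S.Gc := by
  haveI := hF.finite_vertex_base
  haveI := hF.finite_edge_base
  exact edgeLikeIsInfVerticialAt_of_finiteGraph

/-- `EdgeLikeIsInfVerticialAt` at the level-`i` special fibre. [cite: MochizukiSemiAnbd2006, Thm 3.7(iv) p.41] -/
theorem edgeLikeIsInfVerticialAt_level (i : ℕ) : EdgeLikeIsInfVerticialAt (T.Gc i) := by
  haveI := hF.finite_vertex i
  haveI := hF.finite_edge i
  exact edgeLikeIsInfVerticialAt_of_finiteGraph

/-- `EdgeLikeDistinctAt` at the base special fibre. [cite: MochizukiSemiAnbd2006, Thm 3.7(ii)(iv) pp.40-41] -/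
theorem edgeLikeDistinctAt_base : EdgeLikeDistinctAt S.Gc := by
  haveI := hF.finite_vertex_base
  haveI := hF.finite_edge_base
  exact edgeLikeDistinctAt_of_finiteGraph

/-- `EdgeLikeDistinctAt` at the level-`i` special fibre. [cite: MochizukiSemiAnbd2006, Thm 3.7(ii)(iv) pp.40-41] -/
theorem edgeLikeDistinctAt_level (i : ℕ) : EdgeLikeDistinctAt (T.Gc i) := by
  haveI := hF.finite_vertex i
  haveI := hF.finite_edge i
  exact edgeLikeDistinctAt_of_finiteGraph

/-! ### The bodies at the structures' own Thm. 3.7 hypotheses `S.hyp`, `T.hyp i`, for every chart -/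

/-- **Every compact subgroup of `π₁^temp(𝒢^c)` (any chart) lies in a verticial subgroup** — Thm. 3.7 (iii),
first clause, at the base special fibre, hypothesis-free given the record. [cite: MochizukiSemiAnbd2006, Thm 3.7(iii) p.41] -/
theorem exists_verticial_ge_of_isCompact_base (c : TemperedPiChart S.Gc) (C : Subgroup c.G)
    (hC : IsCompact (C : Set c.G)) :
    ∃ (v : S.Gc.graph.Vertex) (H : Subgroup c.G), H ∈ verticialSubgroups c v ∧ C ≤ H :=
  (hF.compactInVerticialAt_base S.hyp c C hC).1

/-- **Every compact subgroup of `π₁^temp(𝒢^c_i)` (any chart) lies in a verticial subgroup** — Thm. 3.7 (iii),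
first clause, at the level-`i` special fibre. [cite: MochizukiSemiAnbd2006, Thm 3.7(iii) p.41] -/
theorem exists_verticial_ge_of_isCompact_level (i : ℕ) (c : TemperedPiChart (T.Gc i)) (C : Subgroup c.G)
    (hC : IsCompact (C : Set c.G)) :
    ∃ (v : (T.Gc i).graph.Vertex) (H : Subgroup c.G), H ∈ verticialSubgroups c v ∧ C ≤ H :=
  (hF.compactInVerticialAt_level i (T.hyp i) c C hC).1

/-- The same at the tower's own chart `T.chart i` of `π₁^temp(𝒢^c_i)`. [cite: MochizukiSemiAnbd2006, Thm 3.7(iii) p.41] -/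
theorem exists_verticial_ge_of_isCompact_levelChart (i : ℕ) (C : Subgroup (T.chart i).G)
    (hC : IsCompact (C : Set (T.chart i).G)) :
    ∃ (v : (T.Gc i).graph.Vertex) (H : Subgroup (T.chart i).G), H ∈ verticialSubgroups (T.chart i) v ∧ C ≤ H :=
  hF.exists_verticial_ge_of_isCompact_level i (T.chart i) C hC

/-- The same at the special-fibre data's own chart `S.chart` of `π₁^temp(𝒢^c)`. [cite: MochizukiSemiAnbd2006, Thm 3.7(iii) p.41] -/
theorem exists_verticial_ge_of_isCompact_chart (C : Subgroup S.chart.G) (hC : IsCompact (C : Set S.chart.G)) :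
    ∃ (v : S.Gc.graph.Vertex) (H : Subgroup S.chart.G), H ∈ verticialSubgroups S.chart v ∧ C ≤ H :=
  hF.exists_verticial_ge_of_isCompact_base S.chart C hC

/-- **Maximal compact ⇔ verticial** in `π₁^temp(𝒢^c)` (any chart) — Thm. 3.7 (iv), first clause, at the base
special fibre. [cite: MochizukiSemiAnbd2006, Thm 3.7(iv) p.41] -/
theorem isMaximalCompactSubgroup_iff_base (c : TemperedPiChart S.Gc) (K : Subgroup c.G) :
    IsMaximalCompactSubgroup K ↔ ∃ v, K ∈ verticialSubgroups c v :=
  (hF.maximalCompactIffVerticialAt_base S.hyp c).1 K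

/-- **Maximal compact ⇔ verticial** in `π₁^temp(𝒢^c_i)` (any chart) — Thm. 3.7 (iv), first clause, at the
level-`i` special fibre. [cite: MochizukiSemiAnbd2006, Thm 3.7(iv) p.41] -/
theorem isMaximalCompactSubgroup_iff_level (i : ℕ) (c : TemperedPiChart (T.Gc i)) (K : Subgroup c.G) :
    IsMaximalCompactSubgroup K ↔ ∃ v, K ∈ verticialSubgroups c v :=
  (hF.maximalCompactIffVerticialAt_level i (T.hyp i) c).1 K

end FiniteLevels

/-! ### The same keyed on the origin-data record `PiData` (whose field `finite` IS the finiteness record) -/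

namespace PiData

open ProfiniteSemiGraph

variable {p : ℕ} [Fact p.Prime] {X : TemperedCurve p} {d : X.GroupLevelData}
  {S : SpecialFibreData (X.toTemperedArithmeticGroup d)} {T : SpecialFibreTower X.DeltaTemp}
  (P : PiData X d S T)

include P

/-- Thm. 3.7 (iii) AT the base special fibre, from the `Π`-data record (`P.finite`); with `P.N_cofinal` this makes
the Prop. 2.4 (i) tower consumers' binders `hcof` / `hCV` both ONE-TOKEN re-binds at any `P : PiData X d S T`.
[cite: MochizukiSemiAnbd2006, Thm 3.7(iii) p.41] -/
theorem compactInVerticialAt_base : CompactInVerticialAt S.Gc :=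
  P.finite.compactInVerticialAt_base

/-- Thm. 3.7 (iii) AT the level-`i` special fibre, from the `Π`-data record. [cite: MochizukiSemiAnbd2006, Thm 3.7(iii) p.41] -/
theorem compactInVerticialAt_level (i : ℕ) : CompactInVerticialAt (T.Gc i) :=
  P.finite.compactInVerticialAt_level i

/-- Thm. 3.7 (iii) at all levels, from the `Π`-data record (the shape `hCV : ∀ i, CompactInVerticialAt (T.Gc i)`).
[cite: MochizukiSemiAnbd2006, Thm 3.7(iii) p.41] -/
theorem forall_compactInVerticialAt_level : ∀ i, CompactInVerticialAt (T.Gc i) :=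
  P.finite.forall_compactInVerticialAt_level

end PiData

end SpecialFibreTower

end Literature.AnabelianGeometry.SemiGraphs

/-! ### [IUTchI] Prop. 2.1 / 2.2 / Rmk. 2.2.2 at the genuine 𝔛-datum under the finiteness RECORD -/

namespace Literature.IUT.HodgeTheaters

open Literature.AnabelianGeometry.SemiGraphs (SpecialFibreData SpecialFibreTower TemperedCurve)
open Literature.AnabelianGeometry.SemiGraphs.ProfiniteSemiGraph (verticialSubgroups)
open Literature.AnabelianGeometry.AbsoluteAnabelian (IsCommensurablyTerminal)
open scoped Pointwise

namespace StableCurveTemperedData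

variable {p : ℕ} [Fact p.Prime] (X : TemperedCurve p) (d : X.GroupLevelData)
  (S : SpecialFibreData (X.toTemperedArithmeticGroup d)) (h36 : S.Gc.Prop36Hypotheses)
  (Sigma SigmaHat : Set ℕ) (hsub : Sigma ⊆ SigmaHat) (hne : Sigma.Nonempty)
  (hprime : ∀ q ∈ SigmaHat, q.Prime) (hp : p ∉ Sigma)
  (TpH : Subgroup S.chart.G)
  (HatH : Subgroup (TemperedGraphGroupData.exists_completion_of_prop36 S.Gc h36 S.chart).choose)
  (hle : TpH.map (TemperedGraphGroupData.exists_completion_of_prop36 S.Gc h36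
    S.chart).choose_spec.choose.toMonoidHom ≤ HatH)
  (cuspMeetsH : {x : X.Pt // X.IsCusp x} → Prop)
  {T : SpecialFibreTower X.DeltaTemp} (hF : SpecialFibreTower.FiniteLevels X d S T)
  (Λv : S.Gc.graph.Vertex →
    Subgroup (ofSpecialFibre X d S h36 Sigma SigmaHat hsub hne hprime hp TpH HatH hle cuspMeetsH).graph.Tp)
  (hΛv : ∀ v, Λv v ∈ verticialSubgroups S.chart v)
  {E : Type*} (src tgt : E → S.Gc.graph.Vertex)
  (c₁ c₂ : E → (ofSpecialFibre X d S h36 Sigma SigmaHat hsub hne hprime hp TpH HatH hle cuspMeetsH).graph.Tp)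
  (hA3 : ∀ (v w : S.Gc.graph.Vertex)
      (g h : (ofSpecialFibre X d S h36 Sigma SigmaHat hsub hne hprime hp TpH HatH hle cuspMeetsH).graph.Hat),
      MulAut.conj g •
            (Λv v).map (ofSpecialFibre X d S h36 Sigma SigmaHat hsub hne hprime hp TpH HatH hle
              cuspMeetsH).graph.ι ⊓
          MulAut.conj h •
            (Λv w).map (ofSpecialFibre X d S h36 Sigma SigmaHat hsub hne hprime hp TpH HatH hle
              cuspMeetsH).graph.ι ≠ ⊥ →
        (v = w ∧ g⁻¹ * h ∈ (Λv v).map (ofSpecialFibre X d S h36 Sigma SigmaHat hsub hne hprime hp TpH HatH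
          hle cuspMeetsH).graph.ι) ∨
        ∃ (e : E) (k : (ofSpecialFibre X d S h36 Sigma SigmaHat hsub hne hprime hp TpH HatH hle
            cuspMeetsH).graph.Hat),
          ∃ r ∈ (Λv (src e)).map (ofSpecialFibre X d S h36 Sigma SigmaHat hsub hne hprime hp TpH HatH hle
              cuspMeetsH).graph.ι,
          ∃ q ∈ (Λv (tgt e)).map (ofSpecialFibre X d S h36 Sigma SigmaHat hsub hne hprime hp TpH HatH hle
              cuspMeetsH).graph.ι,
            (src e = v ∧ tgt e = w ∧
                g = k * (ofSpecialFibre X d S h36 Sigma SigmaHat hsub hne hprime hp TpH HatH hle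
                  cuspMeetsH).graph.ι (c₁ e) * r ∧
                h = k * (ofSpecialFibre X d S h36 Sigma SigmaHat hsub hne hprime hp TpH HatH hle
                  cuspMeetsH).graph.ι (c₂ e) * q) ∨
            (src e = w ∧ tgt e = v ∧
                h = k * (ofSpecialFibre X d S h36 Sigma SigmaHat hsub hne hprime hp TpH HatH hle
                  cuspMeetsH).graph.ι (c₁ e) * r ∧
                g = k * (ofSpecialFibre X d S h36 Sigma SigmaHat hsub hne hprime hp TpH HatH hle
                  cuspMeetsH).graph.ι (c₂ e) * q))

include hF hΛv hA3

/-- **[IUTchI] Prop. 2.1 AS TYPED at the genuine 𝔛-datum under the finiteness record `FiniteLevels`**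
(`𝔇.graph.ProfiniteConjugatesOfCompactSubgroups`): abc-iut-f-192's `graph_prop21_ofSpecialFibre_of_finiteGraph`
with its instance binders supplied from `hF`; residual = a verticial family and node data with (A3); NO `hCV`.
([IUTchI] Prop 2.1 p.45) [cite: Mochizuki2012, Prop 2.1 p.45] [claim: Mochizuki2012, status: disputed] -/
theorem graph_prop21_ofSpecialFibre_of_finiteLevels :
    (ofSpecialFibre X d S h36 Sigma SigmaHat hsub hne hprime hp TpH HatH hle
      cuspMeetsH).graph.ProfiniteConjugatesOfCompactSubgroups := by
  haveI := hF.finite_vertex_base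
  haveI := hF.finite_edge_base
  exact graph_prop21_ofSpecialFibre_of_finiteGraph X d S h36 Sigma SigmaHat hsub hne hprime hp TpH HatH hle
    cuspMeetsH Λv hΛv src tgt c₁ c₂ hA3

/-- **[IUTchI] Prop. 2.2, "in particular, `Π^tp_𝔾` is commensurably terminal in `Π̂_𝔾`", at the genuine
𝔛-datum under `FiniteLevels`** (abc-iut-f-192's `graph_tp_isCommensurablyTerminal_ofSpecialFibre_of_finiteGraph`).
([IUTchI] Prop 2.2 p.45) [cite: Mochizuki2012, Prop 2.2 p.45] [claim: Mochizuki2012, status: disputed] -/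
theorem graph_tp_isCommensurablyTerminal_ofSpecialFibre_of_finiteLevels :
    IsCommensurablyTerminal
      (ofSpecialFibre X d S h36 Sigma SigmaHat hsub hne hprime hp TpH HatH hle cuspMeetsH).graph.ι.range := by
  haveI := hF.finite_vertex_base
  haveI := hF.finite_edge_base
  exact graph_tp_isCommensurablyTerminal_ofSpecialFibre_of_finiteGraph X d S h36 Sigma SigmaHat hsub hne hprime hp
    TpH HatH hle cuspMeetsH Λv hΛv src tgt c₁ c₂ hA3

/-- **[IUTchI] Rmk. 2.2.2: `Π^tp_𝔾` NORMALLY terminal in `Π̂_𝔾`, at the genuine 𝔛-datum under `FiniteLevels`**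
(abc-iut-f-192's `graph_temperedNormallyTerminal_ofSpecialFibre_of_finiteGraph`).
([IUTchI] Rmk 2.2.2 p.46) [cite: Mochizuki2012, Rmk 2.2.2 p.46] [claim: Mochizuki2012, status: disputed] -/
theorem graph_temperedNormallyTerminal_ofSpecialFibre_of_finiteLevels :
    (ofSpecialFibre X d S h36 Sigma SigmaHat hsub hne hprime hp TpH HatH hle
      cuspMeetsH).graph.TemperedNormallyTerminal := by
  haveI := hF.finite_vertex_base
  haveI := hF.finite_edge_base
  exact graph_temperedNormallyTerminal_ofSpecialFibre_of_finiteGraph X d S h36 Sigma SigmaHat hsub hne hprime hp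
    TpH HatH hle cuspMeetsH Λv hΛv src tgt c₁ c₂ hA3

end StableCurveTemperedData

end Literature.IUT.HodgeTheaters
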